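import Summits.Ventures.DiscreteObjects.PP12.OrderThirteenOmSearch
import Summits.Ventures.DiscreteObjects.PP12.OrderThirteenShapeBits

/-!
# PP(12), order-13 cell: soundness of the kernel enumeration of doubly lexical orbit matrices, II — completeness of the row generator and of the walker, list lemmas, monotonicity
Framing: lottery ticket; floor = certified bounds/negative ranges.

Cell pub-namedobj (venture DiscreteObjects), target (M). Text: designs gen 21 (`OrderThirteenOmSearchSound`, verified rc 0 as one file); split into four modules `OrderThirteenOmSoundPack` / `…Walk` / `…Search` / `…First` by designs gen 22 for the gate's 400-line rule (declarations and proofs unchanged).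
Here: `mem_genM` (every non-increasing admissible digit list is generated), `chk_sound` (completeness of the walker over a literal candidate list), `chk1_of_split`, the value
trees (`VT.mem_toList`, `mem_of_buildT`), `pairwise_of_sortedB`, list lemmas for `filt` / `children`, and monotonicity of `search` / `searchB` / `childrenN` in the solution list
(run files compare against per-file sub-lists of `SOLS`). No `sorry`, no new axioms; nothing here asserts a census statement.
-/

namespace Summit.Ventures.DiscreteObjects.PP12

namespace Om13

open Finset Shape13

/-! ### completeness of the row generators -/

/-- digit `x ≤ 4` is in the candidate digit list -/
theorem mem_digits5 {x : ℕ} (hx : x ≤ 4) : x ∈ [4, 3, 2, 1, 0] := by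
  have : x = 4 ∨ x = 3 ∨ x = 2 ∨ x = 1 ∨ x = 0 := by omega
  rcases this with h | h | h | h | h <;> simp [h]

/-- every NON-INCREASING digit list with entries `≤ maxd` and the right sum and sum of squares is generated by `genM` -/
theorem mem_genM : ∀ (l : List ℕ) (rem sq maxd : ℕ), (∀ x ∈ l, x ≤ 4) → l.Pairwise (fun a b => b ≤ a) → (∀ x ∈ l, x ≤ maxd) → l.sum = rem →
    sq + (l.map fun x => x * x).sum = 24 → l ∈ genM l.length rem sq maxd
  | [], rem, sq, maxd, _, _, _, hs, hq => by
    simp only [List.sum_nil, List.map_nil] at hs hq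
    subst hs
    simp [genM, show sq = 24 by omega]
  | x :: l, rem, sq, maxd, h4, hp, hm, hs, hq => by
    simp only [List.sum_cons, List.map_cons] at hs hq
    rw [List.pairwise_cons] at hp
    have hx : x ≤ 4 := h4 x (List.mem_cons_self ..)
    have ih := mem_genM l (rem - x) (sq + x * x) x (fun y hy => h4 y (List.mem_cons_of_mem _ hy)) hp.2 hp.1 (by omega) (by rw [← hq]; ring)
    rw [List.length_cons, genM, List.mem_flatMap]
    refine ⟨x, ?_, List.mem_map.2 ⟨l, ih, rfl⟩⟩
    rw [List.mem_filter]
    refine ⟨mem_digits5 hx, ?_⟩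
    have := hm x (List.mem_cons_self ..)
    simp only [Bool.and_eq_true, Shape13.ble_eq_decide, decide_eq_true_eq]
    exact ⟨⟨this, by omega⟩, by omega⟩

/-- for digits `≤ 4`: `Σ d ≤ Σ d²`, `Σ d² ≤ 4 Σ d`, `Σ d ≤ 4·length`, and `Σ d·c ≤ 4 Σ c` -/
theorem digit_sums (l : List ℕ) (h4 : ∀ x ∈ l, x ≤ 4) :
    l.sum ≤ (l.map fun x => x * x).sum ∧ (l.map fun x => x * x).sum ≤ 4 * l.sum ∧ l.sum ≤ 4 * l.length ∧
      ∀ cs : List ℕ, (List.zipWith (fun x c => x * c) l cs).sum ≤ 4 * cs.sum := by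
  induction l with
  | nil => simp
  | cons x l ih =>
    have hx := h4 x (List.mem_cons_self ..)
    obtain ⟨i1, i2, i3, i4⟩ := ih fun y hy => h4 y (List.mem_cons_of_mem _ hy)
    simp only [List.sum_cons, List.map_cons, List.length_cons]
    refine ⟨by nlinarith, by nlinarith, by omega, fun cs => ?_⟩
    cases cs with
    | nil => simp
    | cons c cs =>
      simp only [List.zipWith_cons_cons, List.sum_cons]
      have := i4 cs
      nlinarith

/-- `kids` over a digit list containing `x` with `ok2 … x`: the continuation holds on the prefix extended by `x` -/
theorem kids_true {k : ℕ → ℕ → ℕ → ℕ → Bool} {c : ℕ} {cs : List ℕ} {n rem sq ip pv x : ℕ} :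
    ∀ {xs : List ℕ}, kids k c cs n rem sq ip pv xs = true → x ∈ xs → ok2 c cs n rem sq ip x = true → k (rem - x) (sq + x * x) (ip + x * c) (pv * 256 + x) = true
  | [], _, hx, _ => absurd hx (by simp)
  | y :: ys, h, hx, hok => by
    simp only [kids, Bool.and_eq_true] at h
    rcases List.mem_cons.1 hx with rfl | hx
    · have h1 := h.1; rw [hok] at h1; exact h1
    · exact kids_true h.2 hx hok

/-- **completeness of the walker**: if `chk` succeeds, every admissible continuation `l` (entries `≤ 4`, the right sums against `cs`) of the prefix value `pv`
ends at a value `≥ v₀` or in the tree -/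
theorem chk_sound {T : VT} {v0 : ℕ} : ∀ (l cs : List ℕ) (rem sq ip pv : ℕ), chk T v0 cs l.length rem sq ip pv = true → l.length ≤ cs.length →
    (∀ x ∈ l, x ≤ 4) → l.sum = rem → sq + (l.map fun x => x * x).sum = 24 → ip + (List.zipWith (fun x c => x * c) l cs).sum = 12 →
    v0 ≤ valOf pv l ∨ VT.mem (valOf pv l) T = true
  | [], cs, rem, sq, ip, pv, h, _, _, hs, hq, hi => by
    simp only [List.sum_nil, List.map_nil, List.zipWith_nil_left] at hs hq hi
    subst hs
    have e : chk T v0 cs 0 0 sq ip pv = (bif Nat.beq 0 0 && Nat.beq sq 24 && Nat.beq ip 12 then Nat.ble v0 pv || VT.mem pv T else true) := by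
      cases cs <;> rfl
    rw [List.length_nil, e, show sq = 24 by omega, show ip = 12 by omega, show (Nat.beq 0 0 && Nat.beq 24 24 && Nat.beq 12 12) = true from rfl] at h
    simp only [cond_true, Bool.or_eq_true, Shape13.ble_eq_decide, decide_eq_true_eq] at h
    simpa [valOf] using h
  | x :: l, [], rem, sq, ip, pv, _, hlen, _, _, _, _ => absurd hlen (by simp)
  | x :: l, c :: cs, rem, sq, ip, pv, h, hlen, h4, hs, hq, hi => by
    simp only [List.sum_cons, List.map_cons, List.zipWith_cons_cons, List.length_cons] at hs hq hi hlen
    have hx : x ≤ 4 := h4 x (List.mem_cons_self ..)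
    have h4' : ∀ y ∈ l, y ≤ 4 := fun y hy => h4 y (List.mem_cons_of_mem _ hy)
    rw [List.length_cons, chk] at h
    have hok : ok2 c cs l.length rem sq ip x = true := by
      obtain ⟨d1, d2, d3, d4⟩ := digit_sums l h4'
      have d4' := d4 cs
      simp only [ok2, Bool.and_eq_true, Shape13.ble_eq_decide, decide_eq_true_eq]
      refine ⟨⟨⟨⟨⟨⟨by omega, by omega⟩, by omega⟩, by omega⟩, by omega⟩, by omega⟩, by omega⟩
    have hk := kids_true h (mem_digits5 hx) hok
    exact chk_sound l cs (rem - x) (sq + x * x) (ip + x * c) (pv * 256 + x) hk (by omega) h4' (by omega) (by rw [← hq]; ring) (by rw [← hi]; ring)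

/-- `kids` succeeds if the continuation holds for every digit of the list -/
theorem kids_of_all {k : ℕ → ℕ → ℕ → ℕ → Bool} {c : ℕ} {cs : List ℕ} {n rem sq ip pv : ℕ} :
    ∀ {xs : List ℕ}, (∀ x ∈ xs, k (rem - x) (sq + x * x) (ip + x * c) (pv * 256 + x) = true) → kids k c cs n rem sq ip pv xs = true
  | [], _ => rfl
  | x :: xs, h => by
    rw [kids, Bool.and_eq_true]
    refine ⟨?_, kids_of_all fun y hy => h y (List.mem_cons_of_mem _ hy)⟩
    cases ok2 c cs n rem sq ip x
    · rfl
    · exact h x (List.mem_cons_self ..)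

/-- **the completeness check from its five sub-walks** (second rows starting with `4, 3, 2, 1, 0`; separate kernel declarations) -/
theorem chk1_of_split {c n : ℕ} {cs Ks : List ℕ}
    (h4 : chk (treeOf n Ks) (valOf 0 (c :: cs)) cs 10 (12 - 4) (0 + 4 * 4) (0 + 4 * c) (0 * 256 + 4) = true)
    (h3 : chk (treeOf n Ks) (valOf 0 (c :: cs)) cs 10 (12 - 3) (0 + 3 * 3) (0 + 3 * c) (0 * 256 + 3) = true)
    (h2 : chk (treeOf n Ks) (valOf 0 (c :: cs)) cs 10 (12 - 2) (0 + 2 * 2) (0 + 2 * c) (0 * 256 + 2) = true)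
    (h1 : chk (treeOf n Ks) (valOf 0 (c :: cs)) cs 10 (12 - 1) (0 + 1 * 1) (0 + 1 * c) (0 * 256 + 1) = true)
    (h0 : chk (treeOf n Ks) (valOf 0 (c :: cs)) cs 10 (12 - 0) (0 + 0 * 0) (0 + 0 * c) (0 * 256 + 0) = true) : chk1 (c :: cs) n Ks = true := by
  unfold chk1
  rw [chk]
  refine kids_of_all fun x hx => ?_
  simp only [List.mem_cons, List.mem_nil_iff, or_false] at hx
  rcases hx with rfl | rfl | rfl | rfl | rfl
  exacts [h4, h3, h2, h1, h0]

/-- a found value is a value of the tree -/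
theorem VT.mem_toList {x : ℕ} : ∀ {T : VT}, VT.mem x T = true → x ∈ VT.toList T
  | VT.nil, h => by simp [VT.mem] at h
  | VT.node l v r, h => by
    unfold VT.mem at h
    rw [VT.toList, List.mem_append, List.mem_cons]
    cases e : Nat.beq x v
    · rw [e] at h; simp only [cond_false] at h
      cases e' : Nat.blt v x <;> rw [e'] at h
      · exact Or.inr (Or.inr (VT.mem_toList h))
      · exact Or.inl (VT.mem_toList h)
    · rw [Shape13.beq_eq_decide, decide_eq_true_eq] at e; exact Or.inr (Or.inl e)

/-- the values of a built tree come from the list -/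
theorem mem_of_buildT {x : ℕ} : ∀ {f n : ℕ} {l : List ℕ}, x ∈ VT.toList (buildT f n l) → x ∈ l
  | 0, _, _, h => by simp [buildT, VT.toList] at h
  | _ + 1, 0, _, h => by simp [buildT, VT.toList] at h
  | f + 1, n + 1, l, h => by
    rw [buildT] at h
    split at h
    · simp [VT.toList] at h
    · next y rest e =>
      rw [VT.toList, List.mem_append, List.mem_cons] at h
      have hsub : ∀ z ∈ y :: rest, z ∈ l := fun z hz => List.mem_of_mem_drop (by rw [e]; exact hz)
      rcases h with h | h | h
      · exact List.mem_of_mem_take (mem_of_buildT h)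
      · exact hsub _ (by rw [h]; exact List.mem_cons_self ..)
      · exact hsub _ (List.mem_cons_of_mem _ (mem_of_buildT h))

/-- a `sortedB` list is pairwise strictly decreasing in `v` -/
theorem pairwise_of_sortedB : ∀ {l : List Row}, sortedB l = true → l.Pairwise fun a b => b.v < a.v
  | [], _ => List.Pairwise.nil
  | [a], _ => List.pairwise_singleton _ _
  | a :: b :: l, h => by
    simp only [sortedB, Bool.and_eq_true, Shape13.blt_eq_decide, decide_eq_true_eq] at h
    have ih := pairwise_of_sortedB h.2
    refine List.pairwise_cons.2 ⟨fun x hx => ?_, ih⟩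
    rcases List.mem_cons.1 hx with rfl | hx
    · exact h.1
    · exact lt_trans (List.rel_of_pairwise_cons ih hx) h.1

/-! ### list lemmas for the search -/

/-- membership in a filtered candidate list -/
theorem mem_filt {r x : Row} : ∀ {l : List Row}, x ∈ filt r l ↔ x ∈ l ∧ ipOK r x = true
  | [] => by simp [filt]
  | y :: l => by
    unfold filt
    cases h : ipOK r y
    · simp only [cond_false, List.mem_cons, mem_filt]
      constructor
      · rintro ⟨hm, hi⟩; exact ⟨Or.inr hm, hi⟩
      · rintro ⟨rfl | hm, hi⟩
        · rw [h] at hi; exact absurd hi (by simp)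
        · exact ⟨hm, hi⟩
    · simp only [cond_true, List.mem_cons, mem_filt]
      constructor
      · rintro (rfl | ⟨hm, hi⟩); exacts [⟨Or.inl rfl, h⟩, ⟨Or.inr hm, hi⟩]
      · rintro ⟨rfl | hm, hi⟩; exacts [Or.inl rfl, Or.inr ⟨hm, hi⟩]

/-- a filtered list is a sublist -/
theorem filt_sublist (r : Row) : ∀ l : List Row, (filt r l).Sublist l
  | [] => by simp [filt]
  | y :: l => by
    unfold filt
    cases ipOK r y
    · exact (filt_sublist r l).cons _
    · exact (filt_sublist r l).cons_cons _

/-- `children` over a list containing `r` checks the child of `r` with the elements after it -/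
theorem children_of_mem {k : St → Bool} {st : St} {r : Row} {rest : List Row} :
    ∀ {pre : List Row}, children k st (pre ++ r :: rest) = true → (match step st r rest with | none => true | some st' => k st') = true
  | [], h => by simp only [List.nil_append, children, Bool.and_eq_true] at h; exact h.1
  | x :: pre, h => by
    simp only [List.cons_append, children, Bool.and_eq_true] at h
    exact children_of_mem h.2

/-- in a strictly decreasing list, the elements smaller than a member come after it -/
theorem mem_after_of_lt {pre rest : List Row} {r x : Row} (hs : (pre ++ r :: rest).Pairwise fun a b => b.v < a.v)
    (hx : x ∈ pre ++ r :: rest) (hlt : x.v < r.v) : x ∈ rest := by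
  rw [List.pairwise_append] at hs
  rcases List.mem_append.1 hx with h | h
  · exact absurd (hs.2.2 x h r (List.mem_cons_self ..)) (lt_asymm hlt)
  · rcases List.mem_cons.1 h with rfl | h
    · exact absurd hlt (lt_irrefl _)
    · exact h

/-! ### monotonicity in the solution list (run files compare against short per-file sub-lists of `SOLS`) -/

/-- keys found in a sub-list all of whose members are in `S` are found in `S` -/
theorem memKey_of_all {k : ℕ} {l S : List ℕ} (hl : l.all (fun x => memKey x S) = true) (h : memKey k l = true) : memKey k S = true := by
  induction l with
  | nil => simp [memKey] at h
  | cons x xs ih =>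
    simp only [List.all_cons, Bool.and_eq_true] at hl
    simp only [memKey, Bool.or_eq_true, Shape13.beq_eq_decide, decide_eq_true_eq] at h
    rcases h with h | h
    · rw [← h]; exact hl.1
    · exact ih hl.2 h

/-- `children` is monotone in the continuation -/
theorem children_mono {k k' : St → Bool} (hk : ∀ st, k st = true → k' st = true) {st : St} : ∀ {l : List Row}, children k st l = true → children k' st l = true
  | [], _ => rfl
  | r :: rest, h => by
    simp only [children, Bool.and_eq_true] at h ⊢
    refine ⟨?_, children_mono hk h.2⟩
    cases e : step st r rest with
    | none => rfl
    | some st' => have h1 := h.1; rw [e] at h1; exact hk st' h1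

/-- `childrenN` is monotone in the continuation -/
theorem childrenN_mono {k k' : St → Bool} (hk : ∀ st, k st = true → k' st = true) {st : St} : ∀ {n : ℕ} {l : List Row}, childrenN k st n l = true → childrenN k' st n l = true
  | 0, _, _ => rfl
  | _ + 1, [], _ => rfl
  | n + 1, r :: rest, h => by
    simp only [childrenN, Bool.and_eq_true] at h ⊢
    refine ⟨?_, childrenN_mono hk h.2⟩
    cases e : step st r rest with
    | none => rfl
    | some st' => have h1 := h.1; rw [e] at h1; exact hk st' h1

/-- **`search` is monotone in the solution list** -/
theorem search_mono {S S' : List ℕ} (hS : ∀ k, memKey k S = true → memKey k S' = true) : ∀ {f : ℕ} {st : St}, search S f st = true → search S' f st = true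
  | 0, st, h => by rw [search] at h ⊢; exact hS _ h
  | f + 1, st, h => by rw [search] at h ⊢; exact children_mono (fun _ h' => search_mono hS h') h

/-- **`searchB` is monotone in the solution list** -/
theorem searchB_mono {S S' : List ℕ} (hS : ∀ k, memKey k S = true → memKey k S' = true) {orc : List St} {f : ℕ} :
    ∀ {c : ℕ} {st : St}, searchB S orc f c st = true → searchB S' orc f c st = true
  | 0, st, h => by
    rw [searchB, Bool.or_eq_true] at h ⊢
    rcases h with h | h
    · exact Or.inl h
    · exact Or.inr (search_mono hS h)
  | c + 1, st, h => by rw [searchB] at h ⊢; exact children_mono (fun _ h' => searchB_mono hS h') h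

/-- a chunk run is monotone in the solution list -/
theorem childrenN_searchB_mono {S S' : List ℕ} (hS : ∀ k, memKey k S = true → memKey k S' = true) {orc : List St} {f : ℕ} {st : St} {n : ℕ} {l : List Row}
    (h : childrenN (searchB S orc f 0) st n l = true) : childrenN (searchB S' orc f 0) st n l = true :=
  childrenN_mono (fun _ h' => searchB_mono hS h') h

/-- the hypothesis of the monotonicity lemmas from a kernel check of the sub-list -/
theorem memKey_mono_of_all {l S : List ℕ} (hl : l.all (fun x => memKey x S) = true) : ∀ k, memKey k l = true → memKey k S = true :=
  fun _ h => memKey_of_all hl h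

end Om13

end Summit.Ventures.DiscreteObjects.PP12
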